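import Summits.NavierStokesRegularity.NavierStokesRegularity.Theses.TypeIQuarterGate
import Summits.NavierStokesRegularity.NavierStokesRegularity.Theorems.TypeIQuarterGateQuarterLawTypeIStubCountQuarterLaw
import Summits.NavierStokesRegularity.NavierStokesRegularity.Theorems.TypeIQuarterGateLorentzBoundOfEnvelope
import HarnessLib

/-!
# `TypeIQuarterGate`: the scar-envelope pair implies the Lorentz line, BY NAME

Item DAG links for the crux `QuarterLawTypeI` (stmt-NavierStokesRegularity-23726), registered line
`lorentz-upgrade` (stubs `stub_lorentzUpgrade` = item 24108 OPEN; `stub_lorentzCount` landed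
p816300; `stub_countQuarterLaw` landed p815836).

With the slice engine `LorentzOfEnvelope.lorentzBound_of_envelope` (p817704: scar envelope +
Leray–Hopf energy ⟹ uniformly bounded weak-`L³` slices on `[0,T)`):
* `lorentzUpgradeTypeI_of_scarEnvelope : FiniteScarsTypeI → ScarEnvelopeTypeI → LorentzUpgradeTypeI`
  — items 23842 ∧ 23843 ⟹ 24108 (the open stub of the registered line);
* `uniformConcentrationCountTypeI_of_scarEnvelope : FiniteScarsTypeI → ScarEnvelopeTypeI →
  UniformConcentrationCountTypeI` — ⟹ 23970, through the landed `stub_lorentzCount`;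
* `quarterLawTypeI_of_scarEnvelope_via_lorentz : FiniteScarsTypeI → ScarEnvelopeTypeI →
  QuarterLawTypeI` — ⟹ 23726 through the Lorentz line (`stub_countQuarterLaw ∘ stub_lorentzCount`),
  a second kernel route from the scar-envelope pair to the crux, independent of
  `EnvelopeQuarterLaw` (23844) and of the glue `QuarterLawTypeIGlue` (23845);
* `lorentzBound_of_envelopeHypothesis` — the hypothesis of `EnvelopeQuarterLaw` (23844) alone
  (no Type-I rate, no maximality) already yields the conclusion of `LorentzUpgradeTypeI`.

So in the item DAG of the route: `23842 ∧ 23843 ⟹ 24108 ⟹ 23970 ⟺ 23726 ⟹ 23842`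
(the last two arrows: p816056, p816092); the Lorentz upgrade (24108) sits BELOW the scar-envelope
pair and ABOVE the deciding count.

HONEST FRAMING: pure composition of open statements with landed theorems; `FiniteScarsTypeI`,
`ScarEnvelopeTypeI`, `LorentzUpgradeTypeI`, `UniformConcentrationCountTypeI`, `QuarterLawTypeI` all
remain OPEN and nothing about Navier–Stokes regularity or blow-up is claimed. [folklore]
-/

-- the problem directory repeats the summit name (`NavierStokesRegularity/NavierStokesRegularity`)
set_option linter.dupNamespace false

noncomputable section

open Set Filter MeasureTheory Topology Metric
open scoped ENNReal NNReal

namespace Summit.NavierStokesRegularity.NavierStokesRegularity.Theorems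

namespace LorentzOfEnvelope

open Literature.Analysis.FluidPDE Literature.Analysis.FunctionSpaces
open Summit.NavierStokesRegularity.NavierStokesRegularity.Theses.TypeIQuarterGate

/-- **`FiniteScarsTypeI → ScarEnvelopeTypeI → LorentzUpgradeTypeI`** (items 23842 ∧ 23843 ⟹ 24108,
the open stub `stub_lorentzUpgrade` of the registered line `lorentz-upgrade` on 23726): finitely
many scars feed the scar envelope, and the envelope with the Leray–Hopf energy bound is a uniform
weak-`L³` bound (`lorentzBound_of_envelope`). [folklore] -/
theorem lorentzUpgradeTypeI_of_scarEnvelope (hF : FiniteScarsTypeI) (hS : ScarEnvelopeTypeI) :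
    LorentzUpgradeTypeI := by
  intro ν T hν hT u p hmax hLH hdec hI
  exact lorentzBound_of_envelope hν.le hLH
    (hS ν T hν hT u p hmax hLH hdec hI (hF ν T hν hT u p hmax hLH hdec hI))

/-- **The hypothesis of `EnvelopeQuarterLaw` alone gives the Lorentz bound**: for `ν, T > 0`, a
maximal smooth solution, Leray–Hopf from its rapidly decaying datum, under the scar envelope on
`[0,T)` has uniformly bounded weak-`L³` slices on `[0,T)` — the conclusion of
`LorentzUpgradeTypeI`, with no Type-I hypothesis (only the energy is used). [folklore] -/
theorem lorentzBound_of_envelopeHypothesis :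
    ∀ (ν T : ℝ), 0 < ν → 0 < T →
      ∀ (u : ℝ → EuclideanSpace ℝ (Fin 3) → EuclideanSpace ℝ (Fin 3))
        (p : ℝ → EuclideanSpace ℝ (Fin 3) → ℝ),
        IsMaximalSmoothSolution ν 0 u p T → IsLerayHopfOn T ν 0 (u 0) u →
        HasRapidSpatialDecay (u 0) →
        (∃ (σ : Finset (EuclideanSpace ℝ (Fin 3))) (C' : ℝ), ∀ t ∈ Set.Ico 0 T, ∀ x,
          ‖u t x‖ ≤ C' + ∑ a ∈ σ, C' / (‖x - a‖ + Real.sqrt (T - t))) →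
        ∃ M' : ℝ, ∀ t ∈ Set.Ico 0 T, eWeakLpPow (u t) 3 volume ≤ ENNReal.ofReal M' := by
  intro ν T hν _hT u _p _hmax hLH _hdec henv
  exact lorentzBound_of_envelope hν.le hLH henv

/-- **Through the Lorentz line to the uniform concentration count**:
`FiniteScarsTypeI → ScarEnvelopeTypeI → UniformConcentrationCountTypeI` (23842 ∧ 23843 ⟹ 23970), by
the landed stub `stub_lorentzCount` (p816300, = `LorentzCountTypeI_holds`). [folklore] -/
theorem uniformConcentrationCountTypeI_of_scarEnvelope (hF : FiniteScarsTypeI)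
    (hS : ScarEnvelopeTypeI) : UniformConcentrationCountTypeI := by
  intro ν T hν hT u p hmax hLH hdec hI
  exact CountQuarterLaw.stub_lorentzCount ν T hν hT u p hmax hLH hdec hI
    (lorentzUpgradeTypeI_of_scarEnvelope hF hS ν T hν hT u p hmax hLH hdec hI)

/-- **Through the Lorentz line to the quarter law**:
`FiniteScarsTypeI → ScarEnvelopeTypeI → QuarterLawTypeI` by `stub_lorentzCount` (p816300) and
`stub_countQuarterLaw` (p815836) — a second kernel route from the scar-envelope pair to the crux
23726, independent of `EnvelopeQuarterLaw` (23844). [folklore] -/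
theorem quarterLawTypeI_of_scarEnvelope_via_lorentz (hF : FiniteScarsTypeI)
    (hS : ScarEnvelopeTypeI) : QuarterLawTypeI := by
  intro ν T hν hT u p hmax hLH hdec hI
  exact CountQuarterLaw.stub_countQuarterLaw ν T hν hT u p hmax hLH hdec hI
    (uniformConcentrationCountTypeI_of_scarEnvelope hF hS ν T hν hT u p hmax hLH hdec hI)

end LorentzOfEnvelope

end Summit.NavierStokesRegularity.NavierStokesRegularity.Theorems
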